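import Mathlib.Probability.Independence.Basic
import Mathlib.Probability.Independence.Integration
import Mathlib.MeasureTheory.Function.ConditionalExpectation.Basic
import HarnessLib

/-!
# An independent `σ`-field drops out of the conditioning

Topic `Literature/Probability/Independence`.  A standard fact of measure-theoretic probability
(e.g. D. Williams, *Probability with Martingales* (1991), §9.7 (k) "Rôle of independence": if
`𝓗` is independent of `σ(σ(X), 𝓖)` then `E[X | σ(𝓖, 𝓗)] = E[X | 𝓖]` a.s.), in the form needed to
pass Schramm–Smirnov's factorization theorem from bounded cuts to the (unbounded) lines of the
rectangle base (`Literature/Probability/Percolation/QuadCrossingNoiseProofs.lean`):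

* `setIntegral_condExp_indicator_eq_of_indep` — for `σ`-fields `𝓖 ≤ 𝓐` and `𝓣` with `𝓐`, `𝓣`
  independent and an `𝓐`-event `s`, the `𝓖`-conditional probability `μ[1_s | 𝓖]` has the right
  integrals on every set of `𝓖 ∨ 𝓣` (π-λ over the rectangles `u ∩ v`);
* `condExp_indicator_ae_eq_of_indep` — hence if `s` is moreover a.e. equal to a `𝓖 ∨ 𝓣`-set,
  then `μ[1_s | 𝓖] = 1_s` a.e.;
* `exists_measurableSet_ae_eq_of_indep` — and `s` is a.e. equal to a `𝓖`-set: **an `𝓐`-event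
  that is `𝓖 ∨ 𝓣`-measurable mod `0`, with `𝓣` independent of `𝓐 ⊇ 𝓖`, is `𝓖`-measurable mod `0`.**

Mathlib has `MeasureTheory.condExp_indep_eq` (`E[f | m₂] = E[f]` for `f` independent of `m₂`)
but not the version with an extra conditioning field; the proofs here use only the uniqueness
of conditional expectations (`ae_eq_of_forall_setIntegral_eq_of_sigmaFinite'`) and
`IndepFun.integral_fun_mul_eq_mul_integral`.

## References

* D. Williams, *Probability with Martingales*, Cambridge Univ. Press (1991), §9.7 (k).
-/

noncomputable section

open Set Filter
open _root_.MeasureTheory _root_.ProbabilityTheory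

namespace Literature.Probability.Independence

variable {Ω : Type*}

/-- The rectangles `u ∩ v`, `u ∈ 𝓖`, `v ∈ 𝓣`, generate `𝓖 ∨ 𝓣`. [folklore] -/
theorem generateFrom_setOf_inter_eq_sup (mG mT : MeasurableSpace Ω) :
    MeasurableSpace.generateFrom
        {S | ∃ u v : Set Ω, MeasurableSet[mG] u ∧ MeasurableSet[mT] v ∧ S = u ∩ v} = mG ⊔ mT := by
  refine le_antisymm (MeasurableSpace.generateFrom_le ?_) (sup_le ?_ ?_)
  · rintro _ ⟨u, v, hu, hv, rfl⟩
    exact ((le_sup_left : mG ≤ mG ⊔ mT) u hu).inter ((le_sup_right : mT ≤ mG ⊔ mT) v hv)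
  · intro u hu
    exact MeasurableSpace.measurableSet_generateFrom
      ⟨u, univ, hu, MeasurableSet.univ, (inter_univ u).symm⟩
  · intro v hv
    exact MeasurableSpace.measurableSet_generateFrom
      ⟨univ, v, MeasurableSet.univ, hv, (univ_inter v).symm⟩

/-- The rectangles `u ∩ v`, `u ∈ 𝓖`, `v ∈ 𝓣`, form a `π`-system. [folklore] -/
theorem isPiSystem_setOf_inter (mG mT : MeasurableSpace Ω) :
    IsPiSystem {S | ∃ u v : Set Ω, MeasurableSet[mG] u ∧ MeasurableSet[mT] v ∧ S = u ∩ v} := by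
  rintro _ ⟨u, v, hu, hv, rfl⟩ _ ⟨u', v', hu', hv', rfl⟩ -
  exact ⟨u ∩ u', v ∩ v', hu.inter hu', hv.inter hv', inter_inter_inter_comm u v u' v'⟩

/-- **Integrating over a rectangle against an independent factor.**  If `g` is `𝓐`-measurable and
integrable, `u ∈ 𝓐`, `v ∈ 𝓣` and `𝓐`, `𝓣` are independent, then
`∫_{u ∩ v} g dμ = (∫_u g dμ) · μ(v)`. [folklore] -/
theorem setIntegral_inter_eq_mul_of_indep {mA mT m₀ : MeasurableSpace Ω} {μ : Measure Ω}
    (hA : mA ≤ m₀) (hT : mT ≤ m₀) (hind : Indep mA mT μ) {g : Ω → ℝ}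
    (hgm : StronglyMeasurable[mA] g) {u v : Set Ω} (hu : MeasurableSet[mA] u)
    (hv : MeasurableSet[mT] v) :
    ∫ x in u ∩ v, g x ∂μ = (∫ x in u, g x ∂μ) * μ.real v := by
  have hu₀ : MeasurableSet[m₀] u := hA u hu
  have hv₀ : MeasurableSet[m₀] v := hT v hv
  have hX : Measurable[mA] (u.indicator g) := (hgm.indicator hu).measurable
  have hY : Measurable[mT] (v.indicator fun _ => (1 : ℝ)) := measurable_const.indicator hv
  have hXY : IndepFun (u.indicator g) (v.indicator fun _ => (1 : ℝ)) μ := by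
    rw [indepFun_iff_measure_inter_preimage_eq_mul]
    intro a b ha hb
    exact (Indep_iff mA mT μ).1 hind _ _ (hX ha) (hY hb)
  calc ∫ x in u ∩ v, g x ∂μ = ∫ x, (u ∩ v).indicator g x ∂μ :=
        (integral_indicator (hu₀.inter hv₀)).symm
    _ = ∫ x, u.indicator g x * v.indicator (fun _ => (1 : ℝ)) x ∂μ := by
        simp_rw [← inter_indicator_mul, mul_one]
    _ = (∫ x, u.indicator g x ∂μ) * ∫ x, v.indicator (fun _ => (1 : ℝ)) x ∂μ :=
        hXY.integral_fun_mul_eq_mul_integral (hX.mono hA le_rfl).aestronglyMeasurable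
          (hY.mono hT le_rfl).aestronglyMeasurable
    _ = (∫ x in u, g x ∂μ) * μ.real v := by
        rw [integral_indicator hu₀, integral_indicator hv₀, setIntegral_const, smul_eq_mul,
          mul_one]

/-- **Set integrals of `μ[1_s | 𝓖]` over `𝓖 ∨ 𝓣`-sets.**  Let `𝓖 ≤ 𝓐` and `𝓣` be sub-`σ`-fields
with `𝓐`, `𝓣` independent under the probability measure `μ`, and `s ∈ 𝓐`.  Then for every
`S ∈ 𝓖 ∨ 𝓣`, `∫_S μ[1_s | 𝓖] dμ = μ(s ∩ S)` (π-λ from the rectangles `u ∩ v`, where both sides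
equal `μ(s ∩ u) μ(v)`). [folklore] -/
theorem setIntegral_condExp_indicator_eq_of_indep {mG mA mT m₀ : MeasurableSpace Ω}
    {μ : Measure Ω} [IsProbabilityMeasure μ] (hGA : mG ≤ mA) (hA : mA ≤ m₀) (hT : mT ≤ m₀)
    (hind : Indep mA mT μ) {s : Set Ω} (hs : MeasurableSet[mA] s) {S : Set Ω}
    (hS : MeasurableSet[mG ⊔ mT] S) :
    ∫ x in S, (μ[s.indicator fun _ => (1 : ℝ) | mG]) x ∂μ =
      ∫ x in S, s.indicator (fun _ => (1 : ℝ)) x ∂μ := by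
  have hG : mG ≤ m₀ := hGA.trans hA
  have hGT : mG ⊔ mT ≤ m₀ := sup_le hG hT
  have hfi : Integrable (s.indicator fun _ => (1 : ℝ)) μ := (integrable_const 1).indicator (hA s hs)
  have hgi : Integrable (μ[s.indicator fun _ => (1 : ℝ) | mG]) μ := integrable_condExp
  refine @MeasurableSpace.induction_on_inter Ω (mG ⊔ mT)
    (fun S _ => ∫ x in S, (μ[s.indicator fun _ => (1 : ℝ) | mG]) x ∂μ =
      ∫ x in S, s.indicator (fun _ => (1 : ℝ)) x ∂μ) _
    (generateFrom_setOf_inter_eq_sup mG mT).symm (isPiSystem_setOf_inter mG mT)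
    ?_ ?_ ?_ ?_ S hS
  · simp
  · rintro _ ⟨u, v, hu, hv, rfl⟩
    rw [setIntegral_inter_eq_mul_of_indep hA hT hind (stronglyMeasurable_condExp.mono hGA)
        (hGA u hu) hv,
      setIntegral_inter_eq_mul_of_indep hA hT hind (stronglyMeasurable_const.indicator hs)
        (hGA u hu) hv,
      setIntegral_condExp hG hfi hu]
  · intro S hSm h
    have hS₀ : MeasurableSet[m₀] S := hGT S hSm
    have h1 := integral_add_compl hS₀ hgi
    have h2 := integral_add_compl hS₀ hfi
    rw [integral_condExp hG] at h1
    linarith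
  · intro F hdisj hFm hF
    have hF₀ : ∀ i, MeasurableSet[m₀] (F i) := fun i => hGT _ (hFm i)
    rw [integral_iUnion hF₀ hdisj hgi.integrableOn, integral_iUnion hF₀ hdisj hfi.integrableOn]
    exact tsum_congr hF

/-- **`μ[1_s | 𝓖] = 1_s` a.e. when `s ∈ 𝓐` is `𝓖 ∨ 𝓣`-measurable mod `0` and `𝓣` is independent
of `𝓐 ⊇ 𝓖`** (uniqueness of conditional expectations on `𝓖 ∨ 𝓣`). [folklore] -/
theorem condExp_indicator_ae_eq_of_indep {mG mA mT m₀ : MeasurableSpace Ω} {μ : Measure Ω}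
    [IsProbabilityMeasure μ] (hGA : mG ≤ mA) (hA : mA ≤ m₀) (hT : mT ≤ m₀)
    (hind : Indep mA mT μ) {s t : Set Ω} (hs : MeasurableSet[mA] s)
    (ht : MeasurableSet[mG ⊔ mT] t) (hst : s =ᵐ[μ] t) :
    μ[s.indicator fun _ => (1 : ℝ) | mG] =ᵐ[μ] s.indicator fun _ => (1 : ℝ) := by
  have hG : mG ≤ m₀ := hGA.trans hA
  have hGT : mG ⊔ mT ≤ m₀ := sup_le hG hT
  have hfi : Integrable (s.indicator fun _ => (1 : ℝ)) μ := (integrable_const 1).indicator (hA s hs)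
  refine ae_eq_of_forall_setIntegral_eq_of_sigmaFinite' hGT
    (fun S _ _ => integrable_condExp.integrableOn) (fun S _ _ => hfi.integrableOn)
    (fun S hS _ => setIntegral_condExp_indicator_eq_of_indep hGA hA hT hind hs hS) ?_ ?_
  · exact (stronglyMeasurable_condExp.mono (le_sup_left : mG ≤ mG ⊔ mT)).aestronglyMeasurable
  · exact ⟨t.indicator fun _ => (1 : ℝ), stronglyMeasurable_const.indicator ht,
      indicator_ae_eq_of_ae_eq_set hst⟩

/-- **An `𝓐`-event that is `𝓖 ∨ 𝓣`-measurable mod `0`, with `𝓣` independent of `𝓐 ⊇ 𝓖`, is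
`𝓖`-measurable mod `0`** (Williams 1991, §9.7 (k), set form): there is `u ∈ 𝓖` with `s = u`
`μ`-a.e. (namely `u = {μ[1_s | 𝓖] = 1}`). [folklore] -/
theorem exists_measurableSet_ae_eq_of_indep {mG mA mT m₀ : MeasurableSpace Ω} {μ : Measure Ω}
    [IsProbabilityMeasure μ] (hGA : mG ≤ mA) (hA : mA ≤ m₀) (hT : mT ≤ m₀)
    (hind : Indep mA mT μ) {s t : Set Ω} (hs : MeasurableSet[mA] s)
    (ht : MeasurableSet[mG ⊔ mT] t) (hst : s =ᵐ[μ] t) :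
    ∃ u : Set Ω, MeasurableSet[mG] u ∧ s =ᵐ[μ] u := by
  refine ⟨(μ[s.indicator fun _ => (1 : ℝ) | mG]) ⁻¹' {1},
    stronglyMeasurable_condExp.measurable (measurableSet_singleton 1), ?_⟩
  filter_upwards [condExp_indicator_ae_eq_of_indep hGA hA hT hind hs ht hst] with x hx
  change (x ∈ s) = (x ∈ (μ[s.indicator fun _ => (1 : ℝ) | mG]) ⁻¹' {1})
  apply propext
  rw [mem_preimage, mem_singleton_iff, hx]
  by_cases h : x ∈ s <;> simp [h]

end Literature.Probability.Independence
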